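import Summits.ResolutionOfSingularities.ResolutionOfSingularities.Theorems.WeightedInvariantWeightedConstructionFatPointSingular
import Summits.ResolutionOfSingularities.ResolutionOfSingularities.Theorems.WeightedInvariantWeightedConstructionHullEscape

/-!
# Fat points: the hull of every pointwise-lexmax-hull rule at the origin of `(𝔸ⁿ, 𝔪₀²)` is `(2,…,2,⊤,…)`

[OURS · L1 W4.3 · chain w43, stub worker 4] The value of the witness family of the hull-escape argument
for line `pointwise-lexmax-hull`, crux `WeightedConstruction` (stmt-ResolutionOfSingularities-0571).
NOT a statement of any manuscript.

For EVERY rule `R : LexmaxHullRule p`, every perfect field `k` of characteristic `p` and every `n ≥ 1`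
(structure map of `𝔸ⁿ_k = Spec k[x₁,…,xₙ]` smooth, separated, quasi-compact): at the origin of
`(Spec k[x₁,…,xₙ], 𝔪₀²)` — the unique singular point (`xSing_fatPoint_iff`, p470274), closed — the rule's
`hull` equals `plex` (the origin is its own only singular generisation) which equals
`chartProfile 2 (1,…,1) = (2,…,2,⊤,…)` with `n` twos (`plex_fatPoint_eq`, p469569):
`LexmaxHullRule.hull_fatPoint_eq`. Since these profiles strictly descend in `n` (`twoProfile_succ_lt`,
p467634), the rule's hull-maximum locus on `Fₙ ⊔ Fₙ₊₁` is the origin of `Fₙ` alone (given the rule's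
`HullComap` along the two open immersions) — the input of `hullEscape_false_of_hull_lt`.
-/

noncomputable section

open CategoryTheory AlgebraicGeometry Topology
open Literature.AlgebraicGeometry.Resolution

set_option linter.dupNamespace false -- mandated namespace of this single-conjunct summit

namespace Summit.ResolutionOfSingularities.ResolutionOfSingularities.Theorems.PointwiseLexmaxHull

/-- The origin of `Spec k[x₁,…,xₙ]` is a closed point. [OURS · folklore] -/
theorem isClosed_singleton_fatPointOrigin (n : ℕ) (k : Type) [Field k] :
    IsClosed ({(⟨RingHom.ker (MvPolynomial.constantCoeff : MvPolynomial (Fin n) k →+* k),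
        RingHom.ker_isPrime _⟩ : Spec (.of (MvPolynomial (Fin n) k)))} :
        Set (Spec (.of (MvPolynomial (Fin n) k)))) := by
  haveI h𝔪 : (RingHom.ker (MvPolynomial.constantCoeff : MvPolynomial (Fin n) k →+* k)).IsMaximal :=
    RingHom.ker_isMaximal_of_surjective _
      fun a => ⟨MvPolynomial.C a, MvPolynomial.constantCoeff_C _ a⟩
  exact (PrimeSpectrum.isClosed_singleton_iff_isMaximal _).mpr h𝔪

/-- **The hull at a fat point.** For every rule, at the origin of `(Spec k[x₁,…,xₙ], 𝔪₀²)` (`n ≥ 1`,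
`k` perfect of characteristic `p`), `hull = (2,…,2,⊤,…)` (`n` twos). [OURS · folklore] -/
theorem LexmaxHullRule.hull_fatPoint_eq {p : ℕ} (R : LexmaxHullRule p) {n : ℕ} (hn : 1 ≤ n)
    (k : Type) [Field k] [CharP k p] [PerfectField k]
    [Smooth (Spec.map (CommRingCat.ofHom (algebraMap k (MvPolynomial (Fin n) k))))]
    [IsSeparated (Spec.map (CommRingCat.ofHom (algebraMap k (MvPolynomial (Fin n) k))))]
    [QuasiCompact (Spec.map (CommRingCat.ofHom (algebraMap k (MvPolynomial (Fin n) k))))] :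
    R.hull (Spec.map (CommRingCat.ofHom (algebraMap k (MvPolynomial (Fin n) k))))
      (Scheme.IdealSheafData.ofIdealTop
        (((RingHom.ker (MvPolynomial.constantCoeff : MvPolynomial (Fin n) k →+* k)) ^ 2).map
          (Scheme.ΓSpecIso (.of (MvPolynomial (Fin n) k))).inv.hom))
      ⟨RingHom.ker (MvPolynomial.constantCoeff : MvPolynomial (Fin n) k →+* k),
        RingHom.ker_isPrime _⟩ = chartProfile (m := n) 2 (fun _ => 1) := by
  have hclosed := isClosed_singleton_fatPointOrigin n k
  have hsing : XSing (Scheme.IdealSheafData.ofIdealTop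
        (((RingHom.ker (MvPolynomial.constantCoeff : MvPolynomial (Fin n) k →+* k)) ^ 2).map
          (Scheme.ΓSpecIso (.of (MvPolynomial (Fin n) k))).inv.hom))
      (⟨RingHom.ker (MvPolynomial.constantCoeff : MvPolynomial (Fin n) k →+* k),
        RingHom.ker_isPrime _⟩ : Spec (.of (MvPolynomial (Fin n) k))) :=
    (xSing_fatPoint_iff hn _).mpr rfl
  have hiso : ∀ η : Spec (.of (MvPolynomial (Fin n) k)),
      η ⤳ (⟨RingHom.ker (MvPolynomial.constantCoeff : MvPolynomial (Fin n) k →+* k),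
        RingHom.ker_isPrime _⟩ : Spec (.of (MvPolynomial (Fin n) k))) →
      XSing (Scheme.IdealSheafData.ofIdealTop
        (((RingHom.ker (MvPolynomial.constantCoeff : MvPolynomial (Fin n) k →+* k)) ^ 2).map
          (Scheme.ΓSpecIso (.of (MvPolynomial (Fin n) k))).inv.hom)) η →
      η = ⟨RingHom.ker (MvPolynomial.constantCoeff : MvPolynomial (Fin n) k →+* k),
        RingHom.ker_isPrime _⟩ :=
    fun η _ hη => (xSing_fatPoint_iff hn η).mp hη
  rw [R.hull_eq_gen_of_isolated _ _ hsing hiso, R.gen_eq_plex_of_isClosed _ _ hclosed hsing]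
  exact R.plex_fatPoint_eq n k hclosed hsing

/-- **The fat-point hulls strictly descend**: for every rule and `1 ≤ n`, the hull at the origin of
`(𝔸ⁿ⁺¹, 𝔪₀²)` is strictly below the hull at the origin of `(𝔸ⁿ, 𝔪₀²)`. [OURS · folklore] -/
theorem LexmaxHullRule.hull_fatPoint_succ_lt {p : ℕ} (R : LexmaxHullRule p) {n : ℕ} (hn : 1 ≤ n)
    (k : Type) [Field k] [CharP k p] [PerfectField k]
    [Smooth (Spec.map (CommRingCat.ofHom (algebraMap k (MvPolynomial (Fin n) k))))]
    [IsSeparated (Spec.map (CommRingCat.ofHom (algebraMap k (MvPolynomial (Fin n) k))))]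
    [QuasiCompact (Spec.map (CommRingCat.ofHom (algebraMap k (MvPolynomial (Fin n) k))))]
    [Smooth (Spec.map (CommRingCat.ofHom (algebraMap k (MvPolynomial (Fin (n + 1)) k))))]
    [IsSeparated (Spec.map (CommRingCat.ofHom (algebraMap k (MvPolynomial (Fin (n + 1)) k))))]
    [QuasiCompact (Spec.map (CommRingCat.ofHom (algebraMap k (MvPolynomial (Fin (n + 1)) k))))] :
    R.hull (Spec.map (CommRingCat.ofHom (algebraMap k (MvPolynomial (Fin (n + 1)) k))))
      (Scheme.IdealSheafData.ofIdealTop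
        (((RingHom.ker (MvPolynomial.constantCoeff : MvPolynomial (Fin (n + 1)) k →+* k)) ^ 2).map
          (Scheme.ΓSpecIso (.of (MvPolynomial (Fin (n + 1)) k))).inv.hom))
      ⟨RingHom.ker (MvPolynomial.constantCoeff : MvPolynomial (Fin (n + 1)) k →+* k),
        RingHom.ker_isPrime _⟩ <
    R.hull (Spec.map (CommRingCat.ofHom (algebraMap k (MvPolynomial (Fin n) k))))
      (Scheme.IdealSheafData.ofIdealTop
        (((RingHom.ker (MvPolynomial.constantCoeff : MvPolynomial (Fin n) k →+* k)) ^ 2).map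
          (Scheme.ΓSpecIso (.of (MvPolynomial (Fin n) k))).inv.hom))
      ⟨RingHom.ker (MvPolynomial.constantCoeff : MvPolynomial (Fin n) k →+* k),
        RingHom.ker_isPrime _⟩ := by
  rw [R.hull_fatPoint_eq hn k, R.hull_fatPoint_eq (Nat.le_succ_of_le hn) k]
  exact twoProfile_succ_lt n

end Summit.ResolutionOfSingularities.ResolutionOfSingularities.Theorems.PointwiseLexmaxHull

end
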